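import Literature.MathematicalPhysics.QuantumLattice.FermionGammaFunctor
import Literature.MathematicalPhysics.QuantumLattice.HubbardHubbardModelEtaODLROProofs
import HarnessLib

/-!
# Every Slater state is a multiple of a unitarily rotated occupation-basis vector

Topic `MathematicalPhysics/QuantumLattice`, family `hubbard` (written for route `SignStructure`,
support `SlaterRankBound`, stmt-HubbardSuperconductivity-2140; generic Fock-space facts).

**Every Slater state is a multiple of a unitarily rotated occupation-basis vector**: for arbitrary
(unnormalised, possibly dependent) orbitals `φ₀, …, φ_{N-1}`,

  `c†(φ₀) ⋯ c†(φ_{N-1}) |∅⟩ = c · Γ(U) |T⟩`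

for some one-body unitary `U`, scalar `c` and coordinate set `T` (`exists_unitary_smul_Gamma_single`).
Proof: choose an orthonormal basis `b` of `ℂ^ι` whose members indexed by `T` span the span `W` of
the orbitals (Gram–Schmidt / Mathlib's `Orthonormal.exists_orthonormalBasis_extension_of_card_eq`);
with `U` the unitary of columns `b_j`, the rotated orbitals `r_k = Uᴴ φ_k` are supported on `T`,
`c†(φ_k) = c†(U r_k)`, the intertwining `Γ(U) c†(f) = c†(Uf) Γ(U)` of `FermionGammaFunctor` moves
`Γ(U)` out, and an `N`-particle vector supported inside `T` with `|T| ≤ N` is a multiple of `|T⟩`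
(zero if `|T| < N`, i.e. if the orbitals are linearly dependent).

Sources: A. J. Coleman, Rev. Mod. Phys. 35 (1963) 668, §3; O. Bratteli, D. W. Robinson II §5.2.1.
No definition is introduced.
-/

namespace Literature.MathematicalPhysics.QuantumLattice

open Matrix Finset
open scoped InnerProductSpace
open Literature.MathematicalPhysics.QuantumLattice.RayleighBound

variable {ι : Type*} [LinearOrder ι] [Fintype ι]

/-! ### Products of smeared creation operators -/

/-- `Γ(g)` passes through a product of smeared creation operators, rotating each orbital:
`Γ(g) c†(r₀)⋯c†(r_{N-1}) = c†(g r₀)⋯c†(g r_{N-1}) Γ(g)`. [cite: BratteliRobinsonII1997, §5.2.1] -/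
theorem Gamma_mul_listProd_create (g : Matrix ι ι ℂ) {N : ℕ} (r : Fin N → ι → ℂ) :
    Gamma g * (List.ofFn fun k => create (r k)).prod =
      (List.ofFn fun k => create (g *ᵥ r k)).prod * Gamma g := by
  induction N with
  | zero => rw [List.ofFn_zero, List.ofFn_zero, List.prod_nil, Matrix.mul_one, Matrix.one_mul]
  | succ N ih =>
    rw [List.ofFn_succ, List.ofFn_succ, List.prod_cons, List.prod_cons, ← Matrix.mul_assoc,
      Gamma_mul_create, Matrix.mul_assoc, ih (fun k => r k.succ), Matrix.mul_assoc]

/-- A product of `N` smeared creation operators on the vacuum is an `N`-particle vector. [folklore] -/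
theorem isNParticle_listProd_create_vacuum {N : ℕ} (r : Fin N → ι → ℂ) :
    IsNParticle N ((List.ofFn fun k => create (r k)).prod *ᵥ (vacuum : Fock ι)) := by
  induction N with
  | zero =>
    rw [List.ofFn_zero, List.prod_nil, one_mulVec]
    exact EtaPairingODLRO.isNParticle_vacuum
  | succ N ih =>
    rw [List.ofFn_succ, List.prod_cons, ← mulVec_mulVec]
    exact (ih fun k => r k.succ).create_mulVec _

/-- If every orbital is supported on `T`, the product state is supported on subsets of `T`.
[folklore] -/
theorem subset_of_listProd_create_vacuum_ne_zero {N : ℕ} (r : Fin N → ι → ℂ) (T : Finset ι)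
    (hr : ∀ k i, i ∉ T → r k i = 0) :
    ∀ S : Finset ι, ((List.ofFn fun k => create (r k)).prod *ᵥ (vacuum : Fock ι)) S ≠ 0 → S ⊆ T := by
  induction N with
  | zero =>
    intro S hS
    rw [List.ofFn_zero, List.prod_nil, one_mulVec, vacuum, Pi.single_apply] at hS
    by_cases h : S = ∅
    · rw [h]; exact Finset.empty_subset T
    · exact absurd (if_neg h) hS
  | succ N ih =>
    intro S hS
    rw [List.ofFn_succ, List.prod_cons, ← mulVec_mulVec, create_mulVec_apply] at hS
    obtain ⟨i, -, hi⟩ := Finset.exists_ne_zero_of_sum_ne_zero hS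
    have hiT : i ∈ T := by
      by_contra hiT
      exact hi (by rw [hr 0 i hiT, zero_mul])
    by_cases hiS : i ∈ S
    · rw [if_pos hiS] at hi
      have hψ : ((List.ofFn fun k => create (r (Fin.succ k))).prod *ᵥ (vacuum : Fock ι)) (S.erase i) ≠ 0 := by
        intro h0
        exact hi (by rw [h0, mul_zero, mul_zero])
      have hsub := ih (fun k => r k.succ) (fun k j hj => hr k.succ j hj) (S.erase i) hψ
      intro x hx
      by_cases hxi : x = i
      · rw [hxi]; exact hiT
      · exact hsub (Finset.mem_erase.2 ⟨hxi, hx⟩)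
    · exact absurd (by rw [if_neg hiS, mul_zero]) hi

omit [Fintype ι] in
/-- An `N`-particle vector supported on subsets of a set `T` with `|T| ≤ N` is a multiple of `|T⟩`
(it vanishes if `|T| < N`). [folklore] -/
theorem eq_smul_single_of_subset {N : ℕ} {ψ : Fock ι} (hN : IsNParticle N ψ) {T : Finset ι}
    (hT : T.card ≤ N) (hsupp : ∀ S, ψ S ≠ 0 → S ⊆ T) :
    ψ = ψ T • (Pi.single T (1 : ℂ) : Fock ι) := by
  funext S
  rw [Pi.smul_apply, Pi.single_apply, smul_eq_mul]
  by_cases hS : S = T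
  · rw [hS, if_pos rfl, mul_one]
  · rw [if_neg hS, mul_zero]
    by_contra h
    have hsub := hsupp S h
    have hcard : S.card = N := by
      by_contra hc
      exact h (hN S hc)
    exact hS (Finset.eq_of_subset_of_card_le hsub (hT.trans hcard.symm.le))

/-! ### The unitary reduction -/

/-- **Every Slater state is a multiple of a rotated occupation-basis vector**:
`c†(φ₀)⋯c†(φ_{N-1})|∅⟩ = c • Γ(U)|T⟩` with `U` unitary. [cite: Coleman1963, §3] -/
theorem exists_unitary_smul_Gamma_single {N : ℕ} (φ : Fin N → ι → ℂ) :
    ∃ U ∈ Matrix.unitaryGroup ι ℂ, ∃ (c : ℂ) (T : Finset ι),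
      (List.ofFn fun k => create (φ k)).prod *ᵥ (vacuum : Fock ι) =
        c • (Gamma U *ᵥ (Pi.single T (1 : ℂ) : Fock ι)) := by
  classical
  -- the span of the orbitals inside `ℂ^ι`, an orthonormal basis of it
  set W : Submodule ℂ (EuclideanSpace ℂ ι) :=
    Submodule.span ℂ (Set.range fun k => (WithLp.toLp 2 (φ k) : EuclideanSpace ℂ ι)) with hW
  set d := Module.finrank ℂ W with hd
  have hdN : d ≤ N := (finrank_range_le_card _).trans (by rw [Fintype.card_fin])
  have hdι : d ≤ Fintype.card ι := by
    rw [hd, ← finrank_euclideanSpace (𝕜 := ℂ) (ι := ι)]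
    exact Submodule.finrank_le W
  set b₀ := stdOrthonormalBasis ℂ W with hb₀
  set x : Fin d → EuclideanSpace ℂ ι := fun m => (b₀ m : EuclideanSpace ℂ ι) with hx
  have hxo : Orthonormal ℂ x := b₀.orthonormal.comp_linearIsometry W.subtypeₗᵢ
  -- index the basis of `W` by an `N`-element… rather `d`-element subset of `ι`
  set e : Fin d ↪ ι := (Fin.castLEEmb hdι).trans (Fintype.equivFin ι).symm.toEmbedding with he
  set v : ι → EuclideanSpace ℂ ι := Function.extend e x 0 with hv
  have hve : ∀ m, v (e m) = x m := fun m => he ▸ e.injective.extend_apply x 0 m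
  have hvo : Orthonormal ℂ ((Set.range e).restrict v) := by
    rw [orthonormal_iff_ite]
    rintro ⟨i, hi⟩ ⟨j, hj⟩
    obtain ⟨m, rfl⟩ := hi
    obtain ⟨m', rfl⟩ := hj
    rw [Set.restrict_apply, Set.restrict_apply, hve, hve, orthonormal_iff_ite.1 hxo m m']
    by_cases hmm : m = m'
    · subst hmm; rw [if_pos rfl, if_pos rfl]
    · rw [if_neg hmm, if_neg (fun h => hmm (e.injective (congrArg Subtype.val h)))]
  obtain ⟨b, hb⟩ := hvo.exists_orthonormalBasis_extension_of_card_eq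
    (finrank_euclideanSpace (𝕜 := ℂ) (ι := ι))
  have hbe : ∀ m, b (e m) = x m := fun m => (hb (e m) ⟨m, rfl⟩).trans (hve m)
  -- the unitary of columns `b j` and the coordinate set `T = e(Fin d)`
  set U : Matrix ι ι ℂ := Matrix.of fun i j => WithLp.ofLp (b j) i with hU
  set T : Finset ι := Finset.univ.map e with hT
  have hTcard : T.card ≤ N := by rw [hT, Finset.card_map, Finset.card_univ, Fintype.card_fin]; exact hdN
  have hinner : ∀ (j : ι) (f : ι → ℂ), (Uᴴ *ᵥ f) j = ⟪b j, WithLp.toLp 2 f⟫_ℂ := by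
    intro j f
    rw [EuclideanSpace.inner_eq_star_dotProduct, WithLp.ofLp_toLp, mulVec, dotProduct, dotProduct]
    refine Finset.sum_congr rfl fun i _ => ?_
    rw [conjTranspose_apply, hU, Matrix.of_apply, Pi.star_apply, mul_comm]
  have hUU : Uᴴ * U = 1 := by
    ext j j'
    have h := orthonormal_iff_ite.1 b.orthonormal j j'
    rw [Matrix.one_apply, ← h, ← hinner j (WithLp.ofLp (b j')), Matrix.mul_apply, mulVec, dotProduct]
    rfl
  have hUmem : U ∈ Matrix.unitaryGroup ι ℂ := by
    rw [Matrix.mem_unitaryGroup_iff', star_eq_conjTranspose, hUU]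
  have hUU' : U * Uᴴ = 1 := mul_eq_one_comm.1 hUU
  -- the rotated orbitals are supported on `T`
  set r : Fin N → ι → ℂ := fun k => Uᴴ *ᵥ φ k with hr
  have hUr : ∀ k, U *ᵥ r k = φ k := fun k => by rw [hr, mulVec_mulVec, hUU', one_mulVec]
  have hmemW : ∀ k, (WithLp.toLp 2 (φ k) : EuclideanSpace ℂ ι) ∈ W :=
    fun k => Submodule.subset_span ⟨k, rfl⟩
  have hrT : ∀ k j, j ∉ T → r k j = 0 := by
    intro k j hj
    rw [hr]
    simp only []
    rw [hinner]
    -- expand `φ k` in the orthonormal basis `b₀` of `W`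
    have hsum := b₀.sum_repr ⟨WithLp.toLp 2 (φ k), hmemW k⟩
    have hcoe : (WithLp.toLp 2 (φ k) : EuclideanSpace ℂ ι) =
        ∑ m, b₀.repr ⟨WithLp.toLp 2 (φ k), hmemW k⟩ m • x m := by
      have := congrArg (Subtype.val) hsum
      simp only [Submodule.coe_sum, Submodule.coe_smul] at this
      exact this.symm
    rw [hcoe, inner_sum]
    refine Finset.sum_eq_zero fun m _ => ?_
    rw [inner_smul_right, ← hbe, orthonormal_iff_ite.1 b.orthonormal, if_neg, mul_zero]
    intro hjm
    exact hj (by rw [hT, hjm]; exact Finset.mem_map_of_mem e (Finset.mem_univ m))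
  -- move `Γ(U)` out and identify the coordinate product state
  set ψr : Fock ι := (List.ofFn fun k => create (r k)).prod *ᵥ (vacuum : Fock ι) with hψr
  have hprod : (List.ofFn fun k => create (φ k)).prod *ᵥ (vacuum : Fock ι) = Gamma U *ᵥ ψr := by
    have h1 : (List.ofFn fun k => create (φ k)) = List.ofFn fun k => create (U *ᵥ r k) := by
      congr 1
      funext k
      rw [hUr]
    rw [h1, hψr, mulVec_mulVec, Gamma_mul_listProd_create, ← mulVec_mulVec, Gamma_mulVec_vacuum]
  have hψ : ψr = ψr T • (Pi.single T (1 : ℂ) : Fock ι) :=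
    eq_smul_single_of_subset (isNParticle_listProd_create_vacuum r) hTcard
      (subset_of_listProd_create_vacuum_ne_zero r T hrT)
  refine ⟨U, hUmem, ψr T, T, ?_⟩
  rw [hprod]
  conv_lhs => rw [hψ]
  rw [mulVec_smul]

end Literature.MathematicalPhysics.QuantumLattice
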